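import Summits.ABC.ABC.Theses.TwistAmplification
import Literature.NumberTheory.DiophantineGeometry.AbcShapeReductionCount
import Literature.NumberTheory.DiophantineGeometry.AbcShapeExponents
import Literature.NumberTheory.DiophantineGeometry.AbcShapeSubBox
import Literature.NumberTheory.DiophantineGeometry.AbcExceptionalSetBounds
import Literature.NumberTheory.DiophantineGeometry.SquarefulSumsDetMethod
import Literature.NumberTheory.DiophantineGeometry.SquarefulSumsCountingTools

/-!
# Skeleton line `fibre-toolkit-lp-wall-map` for crux `MazurKaneLaw` (stmt-ABC-2757)

Route `TwistAmplification`, crux r4 `MazurKaneLaw` =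
`∀ s ∈ (1,2) ∀ ε > 0 ∃ C ∀ N ≥ 2, #{abc triples, c ≤ N, rad(abc) ≤ c^s} ≤ C·N^{s-1+ε}`
(upper half of Mazur's question / Kane's Conjecture 1 on the open range; Kane
arXiv:1104.2635 Thm 2 gives `N^{s-1+ε} + N^{1+ε}`, BBLT arXiv:2410.12234 v2 Thm 1.2 gives
`N^{(23s+3)/40+ε}`).

## The line (idea card `fibre-toolkit-lp-wall-map`, crux-ideate r1 ideator 1; triage r1: 3 × pass)

STEP-0 MAP.  Run the in-tree BBLT reduction `N_s(X) ≤ #classes · max B_M(c; X, Y, Z)`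
(`AbcShapes.abcExponentCount_le_of_shapeCount_le`, Prop. 2.1) and read every FIBRE TOOL as a
linear certificate on the exponents `αᵢ = log_Λ Xᵢ, …` (`AbcShapes.expo`, `Λ = 2C₀`) of a
shape box:
* trivial (`trivial_linear`), geometry of numbers with ARBITRARY index sets — "subset GoN"
  (`geometry_disjunction`, BBLT Prop. 4.1; Kane's lattices are `I = J = K = {level 1}`, the mixed
  lattice `{u_a x_a²} × {u_b} × {u_c}` is `I = {1,2}`), Fourier with saved sets
  (`fourier_linear`, Prop. 3.1) — all in tree and PROVED;
* NEW TO THE LP: the DETERMINANT METHOD at a level `j ≥ 2` with the FULL coefficient saving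
  `|ABC|^{-1/3}` — at `j = 2` the SHARP CONIC bound of Heath-Brown (Ann. Math. 2002, Cor. 2) /
  Browning / Le Boudec Lemma 2, exponent `1/3` — imported from the tree's elementary
  `SquarefulDet.fiberBound` (`stub_detTool`).  BBLT v1 used only the coefficient-UNIFORM affine
  Bombieri–Pila/Heath-Brown bound (its Prop. 3.5) and v2 dropped it; Kane used conics but not
  shapes.  In exponent form: `D ≤ max(L - p_j, L - 1 + ((j-2)p_j + e)/3)`, `e` = total
  deficiency `3 - Σ log_Λ(cᵢ · shape value)`.
A box is TAME at `s` when one tool certifies `D ≤ s - 1 + τ` (`Tame`); `stub_toolkitTame` turns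
the certificate into `B_M ≤ K C₀^{s-1+η}` (pattern `AbcShapeLPInstance` + `AbcShapeEndgame13`),
`stub_shapeTransfer` turns "box law at every `s' ∈ (1,2)`" into the crux (pattern
`bernertEtAl2024_thm_1_3_holds`; `rad ≤ c^s < c^{s'}` absorbs `≤` vs `<`).  What is LEFT — the
WILD boxes `¬Tame` — is the honest residue of the crux after every existing fibre tool, and it
is split by `s` at the ideators' threshold `5/3`: `stub_wallResidual` (`s ∈ [5/3,2)`: at the
binding radical level the wild region is the WALL TRIANGLE `p₁ < 1, p₂ < 1, 2p₁ + p₂ ≥ 3(s-1)`,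
tail `< 2(2-s)`, whose worst point is the forced wall family `P₁ = P₂ = X^{s-1}, P₃ = X^{2-s}`
(`a, b, c = u·x²·w³`, `u ≍ x ≍ N^{(s-1)/3}`, `w ≍ N^{(2-s)/3}`) — the common enemy of cards
`critical-kloosterman-powerful-moduli`, `peyre-level-torsor-v22`, `heegner-cusp-subholzer`) and
`stub_deepResidual` (`s ∈ (1,5/3)`: cube-heavy and twisted-Fermat boxes enter, and at `s → 1⁺`
the stub contains "abc hits `≪ N^δ`"; no r1 lever; HARDEST).

LP FINDINGS of this plan (folder `compute/toolkit_lp.py` + hand analysis in the line card):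
the plateau `{s : best toolkit exponent = 1}` is EXACTLY `[12/7, 2]` (symmetric wall for
`s ≥ 7/4`; asymmetric wall `a = u w³, b = u x² w³, c = u x²` down to `12/7`; below `12/7` the
mixed lattice + Fourier + trivial bounds force `< 1`), so the card's predicted left shift
`37/23 → 5/3` of Kane's plateau is `37/23 → 12/7` with mixed index sets in the kit (`5/3` is the
value for the sub-kit Kane-lattice + sharp conic + Fourier, matching both ideators); in
particular `V(5/3) < 1` rigorously.  The toolkit proves the crux at NO `s < 2`: near `s = 2` the
wild region has width `O(2-s)` but is never empty (full saving `N^{-(2-s)}` on the wall is forced,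
TRIAGE r1-2).

`MazurKaneLaw_of` composes the five stubs into the crux BY NAME (kernel-checked, no `sorry`).

## Disproof used (cdisprove `Disproof.lean`, 2026-08-15T22:51Z, 1151 lines rc 0 — known here
through its evidence notes only: `run/gate/evidence/**` is not mounted in planner/triage jails)
* `mazurKaneLaw_false_without_eps` / `not_lawAt_zero` / `abcExponentCount_not_bigO` (the `ε` is
  load-bearing at EVERY `s`: families `(1, c-1, c)`, `(xⁿ, rⁿ-xⁿ, rⁿ)` sit on `N^{s-1}·log N`) —
  HONOURED: every stub keeps `+η` / `+ε` (`BoxLawOn … C₀^{s-1+η}`, `∀ η > 0`); nothing ε-free.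
* `mazurKaneLaw_false_without_coprime` — HONOURED: all counts are of `shapeTriples` (gcd
  condition built in) and of `IsABCTriple`; the determinant tool USES pairwise coprimality
  (`fiberBound`'s `hcu`, `hvc`) — "the line uses coprimality at `stub_detTool`".
* `mazurKaneLaw_false_without_one_lt` — HONOURED: `s > 1` enters `stub_shapeTransfer` (room
  `s < s' < 2`) and the residual stubs are stated on `(1, 2)` only.
* `lawAt_of_three_le`, `tight_at_one_add_inv`, `abcHitCount_le_of_mazurKaneLaw` (crux ⇒ hits
  `≪ X^δ`) — consistent: the `s → 1⁺` content sits in `stub_deepResidual`, flagged hardest.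
* No `Negative/` lemma has landed for this crux (nothing to import); `ledger negatives --problem
  ABC` = 2 statements (stmt-ABC-1689, stmt-ABC-1205), neither about counting; no stub is an
  instance of either.
-/

noncomputable section

open Finset
open Literature.NumberTheory.DiophantineGeometry
open Literature.NumberTheory.DiophantineGeometry.AbcShapes

namespace Summit.ABC.ABC.Cruxes.MazurKaneLaw.FibreToolkitLpWallMap

/-! ### Exponent bookkeeping of a shape datum `(C₀; c₁, c₂, c₃; X, Y, Z)` (BBLT §6 dictionary,
`AbcShapeExponents`: `Λ = 2C₀`, `αᵢ = log_Λ Xᵢ`, coordinate `i` (from `0`) carries exponent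
`i + 1`) -/

/-- The scale `Λ = 2C₀` of a class at dyadic level `C₀` (`cᵢ · ∏ ·^{i+1} ≤ Λ`). -/
def scale (C₀ : ℕ) : ℝ := 2 * (C₀ : ℝ)

/-- The radical exponent `L = Σᵢ (αᵢ + βᵢ + γᵢ) = log_Λ ∏ᵢ XᵢYᵢZᵢ` of a box
(`≤ s + 3ε` on data admissible for `(s, ε)`). -/
def radExp {M : ℕ} (Λ : ℝ) (X Y Z : Fin M → ℕ) : ℝ :=
  ∑ i, (expo Λ X i + expo Λ Y i + expo Λ Z i)

/-- The total DEFICIENCY `e = 3 - Σⱼ log_Λ (cⱼ · shape value at the corner)` of a box: how far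
`a, b, c` (at the box corner) fall short of the scale `Λ`; `e ≥ 0` on admissible data, the
`c`-part is `O(log_Λ V₂) = o(1)`, the `a`-part is genuine for lopsided triples `a ≪ c^{1-e}`. It
weakens exactly one tool: the determinant method, whose modulus is the product of cofactors. -/
def deficiency {M : ℕ} (Λ : ℝ) (c₁ c₂ c₃ : ℕ) (X Y Z : Fin M → ℕ) : ℝ :=
  3 - (Real.logb Λ ((c₁ * shapeVal X : ℕ) : ℝ) + Real.logb Λ ((c₂ * shapeVal Y : ℕ) : ℝ) +
    Real.logb Λ ((c₃ * shapeVal Z : ℕ) : ℝ))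

/-! ### The fibre toolkit as linear certificates "`D ≤ θ`" on the exponents -/

/-- TRIVIAL tool [BBLT Prop. 2.3 / (6.4), tree `trivial_linear`]: fixing two of the three shape
tuples determines the third up to `τ`: `D ≤ A + B`, `A + C`, `B + C` (`A = Σ αᵢ`, …). -/
def TrivialCertifies {M : ℕ} (Λ θ : ℝ) (X Y Z : Fin M → ℕ) : Prop :=
  (∑ i, expo Λ X i + ∑ i, expo Λ Y i ≤ θ) ∨ (∑ i, expo Λ X i + ∑ i, expo Λ Z i ≤ θ) ∨
    (∑ i, expo Λ Y i + ∑ i, expo Λ Z i ≤ θ)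

/-- GEOMETRY-OF-NUMBERS tool with ARBITRARY index sets `I, J, K` ("subset GoN") [BBLT Prop. 4.1,
tree `shapeCount_le_geometry_sets` / `geometry_disjunction`]:
`D ≤ max(L - (Σ_I α + Σ_J β + Σ_K γ), L - 1 + (Σ_I i αᵢ + Σ_J i βᵢ + Σ_K i γᵢ))` — the "+1"
(number of lattices) and the main term (volume / covolume). Kane's lattices: `I = J = K = {0}`. -/
def GeometryCertifies {M : ℕ} (Λ θ : ℝ) (X Y Z : Fin M → ℕ) : Prop :=
  ∃ I J K : Finset (Fin M),
    radExp Λ X Y Z - (∑ i ∈ I, expo Λ X i + ∑ i ∈ J, expo Λ Y i + ∑ i ∈ K, expo Λ Z i) ≤ θ ∧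
    radExp Λ X Y Z - 1 +
      (∑ i ∈ I, (i : ℝ) * expo Λ X i + ∑ i ∈ J, (i : ℝ) * expo Λ Y i + ∑ i ∈ K, (i : ℝ) * expo Λ Z i) ≤ θ

/-- FOURIER tool with saved sets [BBLT Prop. 3.1 / (6.10), tree `shapeCount_pow_six_mul_le_sets` /
`fourier_linear`]: for sets `S_U, S_V, S_W` of coordinates whose exponents are multiples of
`e_U, e_V, e_W ≥ 2`, `6D ≤ 4L - (Σ_{S_U} α + Σ_{S_V} β + Σ_{S_W} γ)`. -/
def FourierCertifies {M : ℕ} (Λ θ : ℝ) (X Y Z : Fin M → ℕ) : Prop :=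
  ∃ (SU SV SW : Finset (Fin M)) (eU eV eW : ℕ), 2 ≤ eU ∧ 2 ≤ eV ∧ 2 ≤ eW ∧
    (∀ i ∈ SU, eU ∣ (i : ℕ) + 1) ∧ (∀ i ∈ SV, eV ∣ (i : ℕ) + 1) ∧ (∀ i ∈ SW, eW ∣ (i : ℕ) + 1) ∧
    (4 * radExp Λ X Y Z - (∑ i ∈ SU, expo Λ X i + ∑ i ∈ SV, expo Λ Y i + ∑ i ∈ SW, expo Λ Z i)) / 6 ≤ θ

/-- DETERMINANT tool at a coordinate `i ≥ 1` (level `j = i + 1 ≥ 2`; NEW to the LP; exponent form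
of `DetTool` below): fix every variable off coordinate `i`; the fibre `A xʲ + B yʲ = C zʲ` has
`≪ Λ^{o(1)} (1 + (XᵢYᵢZᵢ / ABC)^{1/3})` primitive points (Heath-Brown's determinant method; at
`j = 2` the SHARP CONIC bound with the full `|ABC|^{-1/3}`), `log_Λ (ABC) = 3 - e - (j+1) pᵢ`, so
`D ≤ max(L - pᵢ, L - 1 + ((j - 2) pᵢ + e)/3)` with `pᵢ = αᵢ + βᵢ + γᵢ`, `j - 2 = i - 1`. -/
def DeterminantCertifies {M : ℕ} (Λ θ : ℝ) (c₁ c₂ c₃ : ℕ) (X Y Z : Fin M → ℕ) : Prop :=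
  ∃ i : Fin M, 1 ≤ (i : ℕ) ∧
    radExp Λ X Y Z - (expo Λ X i + expo Λ Y i + expo Λ Z i) ≤ θ ∧
    radExp Λ X Y Z - 1 +
      ((((i : ℕ) : ℝ) - 1) * (expo Λ X i + expo Λ Y i + expo Λ Z i) + deficiency Λ c₁ c₂ c₃ X Y Z) / 3 ≤ θ

/-- A shape datum is TAME at `(s, τ)` when some tool of the kit certifies the exponent
`s - 1 + τ` (the Mazur–Kane law up to `τ`). -/
def Tame (M : ℕ) (s τ : ℝ) (C₀ c₁ c₂ c₃ : ℕ) (X Y Z : Fin M → ℕ) : Prop :=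
  TrivialCertifies (scale C₀) (s - 1 + τ) X Y Z ∨ GeometryCertifies (scale C₀) (s - 1 + τ) X Y Z ∨
    FourierCertifies (scale C₀) (s - 1 + τ) X Y Z ∨
      DeterminantCertifies (scale C₀) (s - 1 + τ) c₁ c₂ c₃ X Y Z

/-- WILD = not tame: no fibre tool reaches the law. This is the residue of the crux after the
whole existing toolkit (the "wall map"): for `s ∈ [12/7, 2)` its worst boxes are the wall family
`(p₁, p₂, p₃) = (s-1, s-1, 2-s)`; see the line card for the necessary conditions it satisfies. -/
def Wild (M : ℕ) (s τ : ℝ) (C₀ c₁ c₂ c₃ : ℕ) (X Y Z : Fin M → ℕ) : Prop :=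
  ¬ Tame M s τ C₀ c₁ c₂ c₃ X Y Z

/-- The trivial region (every datum). -/
def Everywhere (M : ℕ) (_s _τ : ℝ) (_C₀ _c₁ _c₂ _c₃ : ℕ) (_X _Y _Z : Fin M → ℕ) : Prop := True

/-- A region of shape data: a predicate on `(M; s, τ; C₀, c₁, c₂, c₃; X, Y, Z)`. -/
abbrev Region : Type :=
  (M : ℕ) → ℝ → ℝ → ℕ → ℕ → ℕ → ℕ → (Fin M → ℕ) → (Fin M → ℕ) → (Fin M → ℕ) → Prop

/-- THE BOX-LEVEL MAZUR–KANE LAW ON A REGION `R` at exponent `s`: for every `η > 0` and all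
sufficiently small `ε'` (hence `M = ⌊10/ε'²⌋` levels) there is `K` with
`B_M(c; X, Y, Z) ≤ K · C₀^{s-1+η}` for all data admissible for `(s, ε')` (`AbcShapes.Admissible`:
`cᵢ ≤ Λ^{ε'/2}`, `∏ XᵢYᵢZᵢ ≤ Λ^{s+3ε'}`, `cᵢ · shape value ≤ Λ = 2C₀`, `C₀ ≤ V₂ c₃ ∏ Zᵢ^{i+1}`)
lying in `R` with tolerance `τ = η/2`. Implied (for every `R`) by the crux at `s + O(ε')`, so the
residual stubs below are pieces of the conjecture, not strengthenings of it. -/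
def BoxLawOn (R : Region) (s : ℝ) : Prop :=
  ∀ η : ℝ, 0 < η → ∃ ε₀ : ℝ, 0 < ε₀ ∧ ∀ ε' : ℝ, 0 < ε' → ε' ≤ ε₀ → ∃ K : ℝ, 0 ≤ K ∧
    ∀ (C₀ c₁ c₂ c₃ : ℕ) (X Y Z : Fin (numShapes ε') → ℕ),
      AbcShapes.Admissible s ε' C₀ c₁ c₂ c₃ X Y Z →
        R (numShapes ε') s (η / 2) C₀ c₁ c₂ c₃ X Y Z →
          (shapeCount c₁ c₂ c₃ X Y Z : ℝ) ≤ K * (C₀ : ℝ) ^ (s - 1 + η)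

/-! ### The five stub STATEMENTS (named `Prop`s; the registered `stub_*` theorems below restate
them verbatim, and `Registered.stub_*` are their name-keyed aliases used as the hypotheses of
`MazurKaneLaw_of`, as the native skeleton audit requires hypotheses admissible BY NAME — same
device as `Cruxes/LagHandOff/Lines/crosscut-dictionary.lean`) -/

/-- Statement of STUB 1 (the Transfer `C⁺ → crux`): the box law everywhere at every
`s' ∈ (1, 2)` implies `MazurKaneLaw`. -/
def ShapeTransfer : Prop :=
  (∀ s : ℝ, 1 < s → s < 2 → BoxLawOn Everywhere s) →
    Summit.ABC.ABC.Theses.TwistAmplification.MazurKaneLaw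

/-- Statement of STUB 2: the determinant method at one coordinate `i ≥ 1` for the shape count
`B_d`, multiplicative form (the `j = 2` case is the sharp conic bound). With `T` a common bound for
the three terms at the outer corner, `Dτ` a divisor bound below `T`, and `P` any real past the
auxiliary-prime threshold (`N₀ ≤ P`, `2 log((i+2)T³) ≤ P`) and past the cube root
`48 XᵢYᵢZᵢ ≤ A₀B₀C₀ · P³` (`A₀ = c₁ · offVal_{{i}}(X)` the corner cofactor of `xᵢ^{i+1}`):
`B_d ≤ #fibres · Dτ^{3(i+2)} · 24 (i+1)(i+2) · P`, `#fibres = ∏_{j ≠ i} XⱼYⱼZⱼ`. -/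
def DetTool : Prop :=
  ∃ N₀ : ℝ, 0 < N₀ ∧ ∀ {d : ℕ} {c₁ c₂ c₃ : ℕ}, 0 < c₁ → 0 < c₂ → 0 < c₃ →
    ∀ (X Y Z : Fin d → ℕ), (∀ j, 0 < X j) → (∀ j, 0 < Y j) → (∀ j, 0 < Z j) →
    ∀ {T Dτ : ℕ}, c₁ * shapeVal (fun j => 2 * X j) ≤ T → c₂ * shapeVal (fun j => 2 * Y j) ≤ T →
      c₃ * shapeVal (fun j => 2 * Z j) ≤ T → (∀ m : ℕ, m ≠ 0 → m ≤ T → m.divisors.card ≤ Dτ) →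
    ∀ i : Fin d, 1 ≤ (i : ℕ) → ∀ P : ℝ, N₀ ≤ P →
      2 * Real.log ((((i : ℕ) : ℝ) + 2) * (T : ℝ) ^ 3) ≤ P →
      48 * ((X i : ℝ) * Y i * Z i) ≤
        ((c₁ * offVal ({i} : Finset (Fin d)) X : ℕ) : ℝ) * ((c₂ * offVal ({i} : Finset (Fin d)) Y : ℕ) : ℝ) *
          ((c₃ * offVal ({i} : Finset (Fin d)) Z : ℕ) : ℝ) * P ^ 3 →
      (shapeCount c₁ c₂ c₃ X Y Z : ℝ) ≤
        ((subBox ({i} : Finset (Fin d)) X).card * (subBox ({i} : Finset (Fin d)) Y).card *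
            (subBox ({i} : Finset (Fin d)) Z).card : ℕ) *
          (Dτ : ℝ) ^ (3 * ((i : ℕ) + 2)) * (24 * ((((i : ℕ) : ℝ) + 1) * (((i : ℕ) : ℝ) + 2))) * P

/-- Statement of STUB 3: with the determinant tool, TAME boxes obey the law at every
`s ∈ (1, 2)`. -/
def ToolkitTame : Prop :=
  DetTool → ∀ s : ℝ, 1 < s → s < 2 → BoxLawOn Tame s

/-- Statement of STUB 4 (the line's TARGET, open): WILD boxes obey the law for `s ∈ [5/3, 2)`. -/
def WallResidual : Prop :=
  ∀ s : ℝ, 5 / 3 ≤ s → s < 2 → BoxLawOn Wild s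

/-- Statement of STUB 5 (open, HARDEST, not attacked by this line): WILD boxes obey the law for
`s ∈ (1, 5/3)`. -/
def DeepResidual : Prop :=
  ∀ s : ℝ, 1 < s → s < 5 / 3 → BoxLawOn Wild s

/-! ### The registered stubs -/

/-- STUB 1 (M, provable now) — the TRANSFER `C⁺ → MazurKaneLaw`: the box law on every admissible
shape datum at every `s' ∈ (1,2)` gives the crux. Why true / the work (pattern
`bernertEtAl2024_thm_1_3_holds`, `AbcExceptionalSetBoundsMainProofs`): given `1 < s < 2` and
`ε > 0` put `s' = min(s + ε/3, (s+2)/2) ∈ (s, 2)`; since `c ≥ 2`, `rad(abc) ≤ c^s < c^{s'}`, so the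
crux's set at `(s, N)` lies in the set counted by `abcExponentCount s' N` (finite:
`abcExponentCount_finite`; `Set.ncard_le_ncard`); the box law at `s'` with `η = ε/3` and
`ε' ≤ min(ε₀, ε/9)` feeds `abcExponentCount_le_of_shapeCount_le` (`θ = s' - 1 + η ≥ 0`), and
`card_classRange_le ε' (δ := ε/6)` bounds the number of classes by `C' N^{3ε'/2 + ε/6}`; the
exponents add to `≤ s - 1 + ε`. Honours `mazurKaneLaw_false_without_one_lt` (needs room above
`s` below `2`) and keeps `+ε`. Leans on: `AbcShapes.abcExponentCount_le_of_shapeCount_le`,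
`AbcShapes.card_classRange_le`, `abcExponentCount_def`, `Real.rpow_le_rpow_of_exponent_le`. -/
theorem stub_shapeTransfer :
    (∀ s : ℝ, 1 < s → s < 2 → BoxLawOn Everywhere s) →
      Summit.ABC.ABC.Theses.TwistAmplification.MazurKaneLaw := by
  sorry

/-- STUB 2 (L, provable now) — the DETERMINANT METHOD for `B_d` at a coordinate `i ≥ 1`
(level `j = i+1`; `j = 2` is the sharp conic bound `≪ τ-powers · (1 + (XYZ/|ABC|)^{1/3})` of
Heath-Brown 2002 Cor. 2 / Le Boudec Lemma 2 / Browning–Van Valckenborgh Lemma 3). Proof as for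
`shapeCount_le_geometry_sets`: fibre `shapeTriples` over `subBox {i}` (all variables but
`xᵢ, yᵢ, zᵢ`); on a non-empty fibre the coefficients `A = c₁ offVal(x) ≥ A₀`, `B`, `C` are
pairwise coprime (`coprime_terms_of_mem`) and the unknowns are pairwise coprime and coprime to the
other two coefficients, so `SquarefulDet.fiberBound` applies with `n = i`, `e = 1`,
`v = (A, B, C)`, `c = (A, B, -C)`, box `(2Xᵢ, 2Yᵢ, 2Zᵢ)` and an auxiliary prime `p ∈ (P, 2P]` not
dividing `(i+1)ABC` (`SquarefulCount.exists_prime_Ioc_not_dvd`, whose `N₀` is the `N₀` here;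
`log((i+1)ABC) ≤ log((i+2)T³) ≤ P/2`); size: `6·(2Xᵢ)(2Yᵢ)(2Zᵢ) = 48XᵢYᵢZᵢ ≤ A₀B₀C₀P³ < ABC·p³`;
count `≤ 2(i+2)·3(i+1)p · ∏ₖ #{ρ mod vₖ : ρ^{i+1} = 1}` and
`#{ρ mod m : ρⁿ = 1} ≤ (2n)^{ω(m)} ≤ τ(m)^{1+log₂ n} ≤ Dτ^{i+2}` (CRT + cyclicity of odd prime-power
units, `ZMod.isCyclic_units_of_prime_pow`, `IsCyclic.card_pow_eq_one_le`; tree has `n = 2, 3`: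
`SquarefulCount.natCard_sqrtOne_le`, `natCard_cubeRootsOfUnity_le`). Constants are generous on
purpose. Why it might need reshaping: only the bookkeeping (casts, the `Icc (-Z) Z` box of
`fiberBound` vs `Ico X 2X`), not the mathematics. -/
theorem stub_detTool :
    ∃ N₀ : ℝ, 0 < N₀ ∧ ∀ {d : ℕ} {c₁ c₂ c₃ : ℕ}, 0 < c₁ → 0 < c₂ → 0 < c₃ →
      ∀ (X Y Z : Fin d → ℕ), (∀ j, 0 < X j) → (∀ j, 0 < Y j) → (∀ j, 0 < Z j) →
      ∀ {T Dτ : ℕ}, c₁ * shapeVal (fun j => 2 * X j) ≤ T → c₂ * shapeVal (fun j => 2 * Y j) ≤ T →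
        c₃ * shapeVal (fun j => 2 * Z j) ≤ T → (∀ m : ℕ, m ≠ 0 → m ≤ T → m.divisors.card ≤ Dτ) →
      ∀ i : Fin d, 1 ≤ (i : ℕ) → ∀ P : ℝ, N₀ ≤ P →
        2 * Real.log ((((i : ℕ) : ℝ) + 2) * (T : ℝ) ^ 3) ≤ P →
        48 * ((X i : ℝ) * Y i * Z i) ≤
          ((c₁ * offVal ({i} : Finset (Fin d)) X : ℕ) : ℝ) * ((c₂ * offVal ({i} : Finset (Fin d)) Y : ℕ) : ℝ) *
            ((c₃ * offVal ({i} : Finset (Fin d)) Z : ℕ) : ℝ) * P ^ 3 →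
        (shapeCount c₁ c₂ c₃ X Y Z : ℝ) ≤
          ((subBox ({i} : Finset (Fin d)) X).card * (subBox ({i} : Finset (Fin d)) Y).card *
              (subBox ({i} : Finset (Fin d)) Z).card : ℕ) *
            (Dτ : ℝ) ^ (3 * ((i : ℕ) + 2)) * (24 * ((((i : ℕ) : ℝ) + 1) * (((i : ℕ) : ℝ) + 2))) * P := by
  sorry

/-- STUB 3 (L, provable now) — TAME BOXES OBEY THE LAW: given the determinant tool, for
`1 < s < 2`, `η > 0`, any `ε' ≤ ε₀ := 1/4` and `M = numShapes ε'` there is `K` with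
`B_M ≤ K C₀^{s-1+η}` on every admissible datum with `Tame M s (η/2)`. The work (pattern
`AbcShapes.logb_shapeCount_le` + `shapeCount_le_of_admissible_lt_one`): with `Λ = 2C₀`,
`T = V₂Λ`, `Dτ = ⌊C_τ T^{η'/m}⌋` (`Sieve.exists_card_divisors_le_mul_rpow`), each disjunct of
`Tame` bounds `log_Λ B_M` by `s - 1 + η/2 + slack` — trivial: `trivial_linear`; geometry:
`geometry_disjunction` (both of its branches are `≤` the certified `θ`); Fourier:
`fourier_linear`; determinant: a new `det_linear` read off `DetTool` with
`P = max(N₀, 2 log((i+2)T³), (48XᵢYᵢZᵢ/A₀B₀C₀)^{1/3})`, using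
`log_Λ A₀ = log_Λ(c₁ · shapeVal X) - (i+1)αᵢ` (`shapeVal_eq_offVal_mul_onVal`) so that the cube-root
branch is exactly `L - 1 + ((i-1)pᵢ + deficiency)/3 + O(log_Λ 2)` — where
`slack = O_M(log_Λ Dτ + log_Λ 2 + log_Λ V₂ + log_Λ log T) ≤ η/2` for `Λ ≥ Λ₀(M, η)`, smaller `Λ`
going into `K`. No LP is solved here: the certificate is the hypothesis. Size: the 4 dictionary
instantiations + the endgame constants (~400 lines by the tree's precedent). -/
theorem stub_toolkitTame :
    DetTool → ∀ s : ℝ, 1 < s → s < 2 → BoxLawOn Tame s := by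
  sorry

/-- STUB 4 (XL, OPEN — the line's TARGET and the common enemy of every r1 idea) — THE WALL
RESIDUAL: for `s ∈ [5/3, 2)` the WILD boxes (no fibre tool certifies `s - 1 + η/2`) still obey
`B_M ≤ K C₀^{s-1+η}`. What the wild region is (line card §Map, derived from the failing
certificates + `Σ (i+1)(αᵢ+βᵢ+γᵢ) = 3 - e`): at radical level `L` (`Δ = s - L`), `p₁ < 1 - Δ`,
`2p₁ + p₂ ≥ 3L - 3 + e`, tail `Σ_{≥3} < 3 - 2L + p₁ - e`, `L > 3(s-1)/2`, and either
`p₂ < 1 - Δ` (the WALL TRIANGLE, worst point `p₁ = p₂ = s-1`, `p₃ = 2-s`: the family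
`a, b, c = u x² w³`, `u ≍ x ≍ N^{(s-1)/3}`, `w ≍ N^{(2-s)/3}`, where Kane's lattices and the sharp
conic both give `N¹` — one "+1" per fibre — and the truth is `N^{s-1}`) or `e > 3Δ` (LOPSIDED
walls, `a ≪ c^{1-e}`). Why plausibly true: it is implied by the crux at `s + O(ε')`; the refuters'
toy counts on the wall (`u₀x₀²w₀³ + u₁x₁²w₁³ = u₂x₂²w₂³`, TRIAGE r1-2: count/expected flat
`≈ .20–.26` over 5 orders of magnitude, Kane off by `×3900`) sit on the law. Why it might fail /
why it is hard: the saving over the "+1" count must be TOTAL (`N^{-(2-s)}` at the wall parameter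
itself, TRIAGE r1-2 finding), i.e. a level-of-distribution / sub-Holzer-density statement for
the points of the conic bundle among the congruence classes `wᵢ³ ∣ ·` (levers on file:
`peyre-level-torsor-v22` C⁺ = LeBoudecCoefficientAspect, `heegner-cusp-subholzer`
SubHolzerDensityOne, `critical-kloosterman-powerful-moduli` WallCubeSaving with `η(δ) ≥ δ`).
A lever that bounds wild boxes only for `L ≥ L₀` closes this stub on `[s₀, 2)` with
`V(L₀) ≤ s₀ - 1` (`V` = toolkit slice exponent, line card table). -/
theorem stub_wallResidual :
    ∀ s : ℝ, 5 / 3 ≤ s → s < 2 → BoxLawOn Wild s := by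
  sorry

/-- STUB 5 (XL⁺, OPEN, HARDEST — not attacked by this line; recorded so that the composition is
honest about the crux's range `∀ s ∈ (1,2)`) — THE DEEP RESIDUAL: for `s ∈ (1, 5/3)` the wild
boxes obey the law. Below `5/3` the wild region leaves the wall: Fourier beats the wall of every
slice `L < 5/3` (`(3L+1)/6 < 1`) and the worst boxes are cube-heavy (`p₃ ≈ 0.4` at `s = 3/2`,
search value `V(3/2) ≈ 0.86 > 1/2`), down to pure / twisted Fermat cubics `u₀y₀³ + u₁y₁³ = u₂y₂³`
(determinant method gives `1/3` per curve, the "+1" per twist is the whole difficulty; cf. card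
`aligned-power-curve-rigidity`); as `s → 1⁺` the stub contains "abc hits `≪ N^{δ}` for every
`δ > 0`" (record `0.6`, BBLT Thm 1.3 = tree `bernertEtAl2024_thm_1_3_holds`; Disproof
`abcHitCount_le_of_mazurKaneLaw`). Why plausibly true: implied by the crux (Mazur 2000 / Kane
Conj. 1; heuristic `#{n ≤ x : rad n ≤ x^λ} = x^{λ+o(1)}`); no positive-power family of near-hits
is known (Dahmen 2008 lower bound is `exp((log N)^{1/2-ε})`). A natural first bite: certify the
toolkit value `V(s)` below `12/7` by an exact LP (as `AbcLinearProgram` does for `λ < 1`) — a new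
RECORD `N_s ≪ N^{V(s)+ε}` for `s ∈ (37/23·?, 12/7)` as a support theorem, not this stub. -/
theorem stub_deepResidual :
    ∀ s : ℝ, 1 < s → s < 5 / 3 → BoxLawOn Wild s := by
  sorry

/-! ### Consistency: each named statement IS its registered stub (definitionally) -/

theorem shapeTransfer_holds : ShapeTransfer := stub_shapeTransfer
theorem detTool_holds : DetTool := stub_detTool
theorem toolkitTame_holds : ToolkitTame := stub_toolkitTame
theorem wallResidual_holds : WallResidual := stub_wallResidual
theorem deepResidual_holds : DeepResidual := stub_deepResidual

/-! ### Name-keyed aliases of the five statements (the hypotheses of the composition) -/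
namespace Registered

/-- Alias of `ShapeTransfer` keyed by the registered stub name. -/
abbrev stub_shapeTransfer : Prop := ShapeTransfer
/-- Alias of `DetTool` keyed by the registered stub name. -/
abbrev stub_detTool : Prop := DetTool
/-- Alias of `ToolkitTame` keyed by the registered stub name. -/
abbrev stub_toolkitTame : Prop := ToolkitTame
/-- Alias of `WallResidual` keyed by the registered stub name. -/
abbrev stub_wallResidual : Prop := WallResidual
/-- Alias of `DeepResidual` keyed by the registered stub name. -/
abbrev stub_deepResidual : Prop := DeepResidual

end Registered

/-! ### Glue (proved): tame law + wild law = law everywhere -/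

/-- On a common range of `ε'`, the law on the tame boxes and the law on the wild boxes give the
law on every admissible box (case split on `Tame`, constants added). -/
theorem boxLawOn_everywhere_of_tame_wild {s : ℝ} (ht : BoxLawOn Tame s) (hw : BoxLawOn Wild s) :
    BoxLawOn Everywhere s := by
  intro η hη
  obtain ⟨ε₁, hε₁, h₁⟩ := ht η hη
  obtain ⟨ε₂, hε₂, h₂⟩ := hw η hη
  refine ⟨min ε₁ ε₂, lt_min hε₁ hε₂, fun ε' hε' hle => ?_⟩
  obtain ⟨K₁, hK₁, hB₁⟩ := h₁ ε' hε' (hle.trans (min_le_left _ _))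
  obtain ⟨K₂, hK₂, hB₂⟩ := h₂ ε' hε' (hle.trans (min_le_right _ _))
  refine ⟨K₁ + K₂, by positivity, fun C₀ c₁ c₂ c₃ X Y Z hA _ => ?_⟩
  have hC : (0 : ℝ) ≤ (C₀ : ℝ) ^ (s - 1 + η) := by positivity
  have h1C : 0 ≤ K₁ * (C₀ : ℝ) ^ (s - 1 + η) := mul_nonneg hK₁ hC
  have h2C : 0 ≤ K₂ * (C₀ : ℝ) ^ (s - 1 + η) := mul_nonneg hK₂ hC
  by_cases hT : Tame (numShapes ε') s (η / 2) C₀ c₁ c₂ c₃ X Y Z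
  · calc (shapeCount c₁ c₂ c₃ X Y Z : ℝ) ≤ K₁ * (C₀ : ℝ) ^ (s - 1 + η) :=
          hB₁ C₀ c₁ c₂ c₃ X Y Z hA hT
      _ ≤ (K₁ + K₂) * (C₀ : ℝ) ^ (s - 1 + η) := by linarith [add_mul K₁ K₂ ((C₀ : ℝ) ^ (s - 1 + η))]
  · have hW : Wild (numShapes ε') s (η / 2) C₀ c₁ c₂ c₃ X Y Z := hT
    calc (shapeCount c₁ c₂ c₃ X Y Z : ℝ) ≤ K₂ * (C₀ : ℝ) ^ (s - 1 + η) :=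
          hB₂ C₀ c₁ c₂ c₃ X Y Z hA hW
      _ ≤ (K₁ + K₂) * (C₀ : ℝ) ^ (s - 1 + η) := by linarith [add_mul K₁ K₂ ((C₀ : ℝ) ^ (s - 1 + η))]

/-! ### The composition: the five stubs imply the crux, by name -/

/-- `MazurKaneLaw` from the five stubs (pure logic; no `sorry`): for `1 < s < 2`, STUB 3 fed with
STUB 2 gives the law on tame boxes, STUB 4 (`s ≥ 5/3`) or STUB 5 (`s < 5/3`) the law on wild
boxes, the glue lemma the law on all admissible boxes, and STUB 1 transfers the box laws at all
`s' ∈ (1, 2)` to the crux. -/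
theorem MazurKaneLaw_of (h1 : Registered.stub_shapeTransfer) (h2 : Registered.stub_detTool)
    (h3 : Registered.stub_toolkitTame) (h4 : Registered.stub_wallResidual)
    (h5 : Registered.stub_deepResidual) :
    Summit.ABC.ABC.Theses.TwistAmplification.MazurKaneLaw := by
  refine h1 fun s hs1 hs2 => ?_
  have ht : BoxLawOn Tame s := h3 h2 s hs1 hs2
  have hw : BoxLawOn Wild s := by
    rcases le_or_gt (5 / 3 : ℝ) s with h | h
    · exact h4 s h hs2
    · exact h5 s hs1 h
  exact boxLawOn_everywhere_of_tame_wild ht hw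

/-- Wiring check: the registered stubs feed `MazurKaneLaw_of` as stated. -/
example : Summit.ABC.ABC.Theses.TwistAmplification.MazurKaneLaw :=
  MazurKaneLaw_of stub_shapeTransfer stub_detTool stub_toolkitTame stub_wallResidual
    stub_deepResidual

end Summit.ABC.ABC.Cruxes.MazurKaneLaw.FibreToolkitLpWallMap

end
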